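import Summits.KontsevichZagierPeriods.KontsevichZagierPeriods.Theses.HurwitzMicroSectors
import Summits.KontsevichZagierPeriods.KontsevichZagierPeriods.Theorems.SectorTwoSix.Negative.LoadBearing
import Literature.NumberTheory.Transcendental.BoxCoordinatePowerMap

/-!
# `SectorTwoSix` (stmt-KontsevichZagierPeriods-3870, route HurwitzMicroSectors) — line
`jacobian-monomial-absorption`, stub `stub_targets`

The single-move targets on the canonical sector representations `sectorRep P = [box, P(t)/(1−t⁶)]`
(`t = x₀x₁`, `box = (0,1)²`, landed `Theorems/SectorTwoSix/Negative/LoadBearing.lean`), from the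
`n = 2` dilation engine, which is taken as a HYPOTHESIS (it is the neighbouring stub): for
representations `r, r'` on the open box with `r.integrand x = r'.integrand (x₀ᵐ, x₁ᵐ) · m² tᵐ⁻¹` on
the box (`m ≥ 1`), `[r] − [r']` is ONE change-of-variables move. The three targets:

* the monomial evaluation (`m = k + 1`, constant target integrand):
  `[box, (tᵏ − tᵏ⁺⁶)/(1−t⁶)] = [box, tᵏ] ∼ [box, (k+1)⁻²] = [box, (k+1)⁻²(1−s⁶)/(1−s⁶)]`,
  since `tᵏ = (k+1)⁻² · ((k+1)² tᵏ)`;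
* the `m = 2` dilations `[box, 4t²ˢ⁺¹/(1−t⁶)] ∼ [box, (uˢ + uˢ⁺³)/(1−u⁶)]`
  (`(uˢ + uˢ⁺³)/(1−u⁶) = uˢ/(1−u³)` pulled back along `u = t²` with Jacobian `4t`);
* the `m = 3` dilations `[box, 9t³ˢ⁺²/(1−t⁶)] ∼ [box, (uˢ + uˢ⁺² + uˢ⁺⁴)/(1−u⁶)]`
  (`= uˢ/(1−u²)` pulled back along `u = t³` with Jacobian `9t²`).

Each is ONE instance of the engine, hence a relation (`KZ.changeOfVariablesRel_subset_relations`).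
The pointwise identities are ported from the tree work file `Cruxes/SectorTwoSix/Disproof.lean` §7
(`tMono`, `tDil2`, `tDil3`). [Kontsevich–Zagier 2001, §1.2, rule (2)]
-/

noncomputable section

open Set MeasureTheory Polynomial
open Literature.NumberTheory.Transcendental
open Summit.KontsevichZagierPeriods.Theorems.SectorTwoSix.Negative

namespace Summit.KontsevichZagierPeriods.Theorems.HurwitzMicroSectorsSectorTwoSix

/-- On the box the pulled-back denominator `1 − (x₀ᵐx₁ᵐ)⁶` (`m ≠ 0`) does not vanish, since
`x₀ᵐx₁ᵐ = tᵐ ∈ (0,1)`. [folklore] -/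
private theorem one_sub_pow_six_ne_zero {m : ℕ} (hm : m ≠ 0) {x : Fin 2 → ℝ} (hx : x ∈ box) :
    1 - (x 0 ^ m * x 1 ^ m) ^ 6 ≠ 0 := by
  have ht := mul_mem_Ioo hx
  have : (x 0 ^ m * x 1 ^ m) ^ 6 < 1 := by
    rw [← mul_pow, ← pow_mul]
    exact pow_lt_one₀ ht.1.le ht.2 (by omega)
  linarith

/-- The monomial evaluation, pointwise (`m = k + 1`): on the box,
`(tᵏ − tᵏ⁺⁶)/(1−t⁶) = [(k+1)⁻²(1−s⁶)/(1−s⁶)]_{s = tᵏ⁺¹} · (k+1)² tᵏ`. [folklore] -/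
private theorem integrand_mono (k : ℕ) (x : Fin 2 → ℝ) (hx : x ∈ box) :
    (sectorRep (X ^ k - X ^ (k + 6))).integrand x =
      (sectorRep (C (1 / ((k : ℚ) + 1) ^ 2) * (1 - X ^ 6))).integrand (fun i => x i ^ (k + 1)) *
        (((k + 1 : ℕ) : ℝ) ^ 2 * (x 0 * x 1) ^ (k + 1 - 1)) := by
  have hd : 1 - (x 0 * x 1) ^ 6 ≠ 0 := (den_pos hx).ne'
  have hd' : 1 - (x 0 ^ (k + 1) * x 1 ^ (k + 1)) ^ 6 ≠ 0 := one_sub_pow_six_ne_zero (by omega) hx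
  simp only [sectorRep_integrand, sectorFun, map_sub, map_mul, map_pow, aeval_X, aeval_C, map_one,
    Nat.add_sub_cancel, eq_ratCast]
  rw [mul_div_assoc, div_self hd', mul_one, div_eq_iff hd]
  push_cast
  have hk : ((k : ℝ) + 1) ≠ 0 := by positivity
  field_simp
  ring

/-- The `m = 2` dilation, pointwise: on the box,
`4t²ˢ⁺¹/(1−t⁶) = [(uˢ + uˢ⁺³)/(1−u⁶)]_{u = t²} · 4t`. [folklore] -/
private theorem integrand_dil2 (s : ℕ) (x : Fin 2 → ℝ) (hx : x ∈ box) :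
    (sectorRep (4 * X ^ (2 * s + 1))).integrand x =
      (sectorRep (X ^ s + X ^ (s + 3))).integrand (fun i => x i ^ 2) *
        (((2 : ℕ) : ℝ) ^ 2 * (x 0 * x 1) ^ (2 - 1)) := by
  have hd : 1 - (x 0 * x 1) ^ 6 ≠ 0 := (den_pos hx).ne'
  have hd2 : 1 - (x 0 ^ 2 * x 1 ^ 2) ^ 6 ≠ 0 := one_sub_pow_six_ne_zero two_ne_zero hx
  simp only [sectorRep_integrand, sectorFun, map_mul, map_ofNat, map_pow, aeval_X, map_add,
    Nat.cast_ofNat, Nat.add_one_sub_one, pow_one]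
  rw [div_eq_iff hd, div_mul_eq_mul_div, div_mul_eq_mul_div, eq_div_iff hd2]
  ring

/-- The `m = 3` dilation, pointwise: on the box,
`9t³ˢ⁺²/(1−t⁶) = [(uˢ + uˢ⁺² + uˢ⁺⁴)/(1−u⁶)]_{u = t³} · 9t²`. [folklore] -/
private theorem integrand_dil3 (s : ℕ) (x : Fin 2 → ℝ) (hx : x ∈ box) :
    (sectorRep (9 * X ^ (3 * s + 2))).integrand x =
      (sectorRep (X ^ s + X ^ (s + 2) + X ^ (s + 4))).integrand (fun i => x i ^ 3) *
        (((3 : ℕ) : ℝ) ^ 2 * (x 0 * x 1) ^ (3 - 1)) := by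
  have hd : 1 - (x 0 * x 1) ^ 6 ≠ 0 := (den_pos hx).ne'
  have hd3 : 1 - (x 0 ^ 3 * x 1 ^ 3) ^ 6 ≠ 0 := one_sub_pow_six_ne_zero three_ne_zero hx
  simp only [sectorRep_integrand, sectorFun, map_mul, map_ofNat, map_pow, aeval_X, map_add,
    Nat.cast_ofNat, Nat.reduceSub]
  rw [div_eq_iff hd, div_mul_eq_mul_div, div_mul_eq_mul_div, eq_div_iff hd3]
  ring

/-- **The single-move targets on canonical representations, from the engine** (registered stub
`stub_targets` of crux stmt-KontsevichZagierPeriods-3870, line `jacobian-monomial-absorption`).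
Assuming the `n = 2` dilation engine (for `r, r'` on the open box with
`r.integrand x = r'.integrand (x₀ᵐ, x₁ᵐ) · m² (x₀x₁)ᵐ⁻¹` on the box, `m ≥ 1`, `[r] − [r']` is ONE
change of variables): the monomial evaluation
`[box, (tᵏ − tᵏ⁺⁶)/(1−t⁶)] ∼ [box, (k+1)⁻²(1−t⁶)/(1−t⁶)]` (`m = k + 1`), the `m = 2` dilations
`[4t²ˢ⁺¹] ∼ [tˢ + tˢ⁺³]` and the `m = 3` dilations `[9t³ˢ⁺²] ∼ [tˢ + tˢ⁺² + tˢ⁺⁴]` are each ONE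
move, hence relations of the Kontsevich–Zagier calculus. [Kontsevich–Zagier 2001, §1.2, rule (2)] -/
theorem stub_targets :
    (∀ (m : ℕ), 1 ≤ m → ∀ (r r' : KZ.IntegralRep 2),
      r.domain = {x | ∀ i, x i ∈ Set.Ioo (0:ℝ) 1} → r'.domain = {x | ∀ i, x i ∈ Set.Ioo (0:ℝ) 1} →
      (∀ x ∈ r.domain, r.integrand x =
        r'.integrand (fun i => x i ^ m) * ((m : ℝ) ^ 2 * (x 0 * x 1) ^ (m - 1))) →
      KZ.of r - KZ.of r' ∈ KZ.changeOfVariablesRel) →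
    (∀ k : ℕ, KZ.of (sectorRep (X ^ k - X ^ (k + 6))) -
        KZ.of (sectorRep (C (1 / ((k : ℚ) + 1) ^ 2) * (1 - X ^ 6))) ∈ KZ.relations) ∧
    (∀ s : ℕ, KZ.of (sectorRep (4 * X ^ (2 * s + 1))) -
        KZ.of (sectorRep (X ^ s + X ^ (s + 3))) ∈ KZ.relations) ∧
    (∀ s : ℕ, KZ.of (sectorRep (9 * X ^ (3 * s + 2))) -
        KZ.of (sectorRep (X ^ s + X ^ (s + 2) + X ^ (s + 4))) ∈ KZ.relations) := by
  intro hD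
  refine ⟨fun k => ?_, fun s => ?_, fun s => ?_⟩
  · exact KZ.changeOfVariablesRel_subset_relations
      (hD (k + 1) (by omega) (sectorRep (X ^ k - X ^ (k + 6)))
        (sectorRep (C (1 / ((k : ℚ) + 1) ^ 2) * (1 - X ^ 6))) rfl rfl
        fun x hx => integrand_mono k x hx)
  · exact KZ.changeOfVariablesRel_subset_relations
      (hD 2 (by norm_num) (sectorRep (4 * X ^ (2 * s + 1))) (sectorRep (X ^ s + X ^ (s + 3)))
        rfl rfl fun x hx => integrand_dil2 s x hx)
  · exact KZ.changeOfVariablesRel_subset_relations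
      (hD 3 (by norm_num) (sectorRep (9 * X ^ (3 * s + 2)))
        (sectorRep (X ^ s + X ^ (s + 2) + X ^ (s + 4))) rfl rfl fun x hx => integrand_dil3 s x hx)

end Summit.KontsevichZagierPeriods.Theorems.HurwitzMicroSectorsSectorTwoSix

end
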